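import Mathlib
import Summits.NavierStokesRegularity.NavierStokesRegularity.Theorems.LerayQuarterDissipationFiniteDissipationLiouvilleVorticityAmplitude
import Summits.NavierStokesRegularity.NavierStokesRegularity.Theorems.LerayQuarterDissipationFiniteDissipationLiouvilleThresholdLimit
import HarnessLib

/-!
# Crux `FiniteDissipationLiouville` (stmt-NavierStokesRegularity-22144): at the vorticity-amplitude
# threshold `√3/4` the localised DISSIPATION is somewhere small (the slack of the rung), and it is
# continuous along KNSS limits (threshold file 1/2)

Theorems file of route `LerayQuarterDissipation` (lead prover g15; `--supports` the crux; portrait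
fact for the registered stub `stub_envelopeCriticalLiouville` of skeleton `Lines/birth.lean`;
sequel of `…VorticityAmplitude`). Navier–Stokes regularity is NOT proved by anything here; no summit
is.

`𝒟_{C,K}`: Type-I ancient mild fields `V` (KNSS gauge, `IsTypeIAncientMild C V`) with the
quarter-rate law `∫‖DV(t)‖² ≤ K/√(−t)`; `U = lerayOrbit V`, `Ω = lerayVorticity V = curl U`;
`Z_R = ∫φ_R²‖Ω‖²`, `Z_∞(s) = ∫‖Ω(s)‖²`, `D_R = ∫φ_R²|∇Ω|²_F` (squared radial cutoff `φ_R²`).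
`…VorticityAmplitude.eq_zero_of_vorticity_lt`: `(−t)‖curl V‖ ≤ C_ω < √3/4` everywhere ⇒ `V ≡ 0`.
This file treats the EQUALITY case `C_ω = √3/4` by the method of `…ThresholdOne` / `…ThresholdK`,
the slack being here the DISSIPATION itself (which the rung simply discarded):

* `exists_budget_le` — the budget with the dissipation kept: under a linear stretching bound
  `2∫φ_R²⟪DUΩ,Ω⟫ ≤ κ Z_∞`, a uniform bound `Z_∞ ≤ m` and a uniform floor `D_R(σ) ≥ η` (all `σ`),
  `Z_R ≤ 2(κ m − 2η) + 2LM/R` for every `R ≥ 1` (`le_div_of_deriv_le_neg_mul_add`);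
* `exists_sqCutoffDissipation_lt` — **for `‖Ω‖ ≤ C_ω ≤ √3/4` (`2κ ≤ 1`) the localised dissipation is
  somewhere small: `∀ R ≥ 1, ∀ η > 0, ∃ σ, D_R(σ) < η`** (else, with `m = sup_σ Z_∞(σ)`, the budget and
  `R → ∞` give `Z_∞ ≤ m − 4η` everywhere, contradicting the supremum);
* `tendsto_sqCutoffDissipation_zero` — `D_R` at similarity time `0` is continuous along
  KNSS-convergent sequences of the class (dominated convergence with the class-uniform bound on
  `D²U(−1)`; the vorticity gradients converge by `ThresholdOne.tendsto_fderiv_curl_slice`);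
* (file 2/2 `…VorticityAmplitudeThreshold`: no singular member has `(−t)‖curl V‖ ≤ √3/4`; the collar
  `√3/4 + ε(C,K)`.)

HONEST FRAMING. `ε(C,K)` is ineffective (compactness); an explicit-threshold portrait clause of the
singular stratum, parallel to THRESHOLD ONE (`C > 1 + ε(K)`) and the dissipation threshold
(`θ(K)⁴ > 64/27 + ε'(C)`); nothing is removed from the catalogued DSS wall (`TypeIDSSLiouville`,
NECESSARY for the crux); nothing here bears on Navier–Stokes regularity or blow-up.

References: Koch–Nadirashvili–Seregin–Šverák, Acta Math. 203 (2009) §4 (compactness of the class);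
folklore energy method.
-/

noncomputable section

set_option linter.dupNamespace false

namespace Summit.NavierStokesRegularity.NavierStokesRegularity.Theorems.FiniteDissipationLiouville.VorticityAmplitude

open MeasureTheory Set Filter Topology Metric InnerProductSpace Function Real
open scoped RealInnerProductSpace ContDiff ENNReal Laplacian
open Literature.Analysis Literature.Analysis.FluidPDE
open Summit.NavierStokesRegularity.NavierStokesRegularity.Theorems
open Summit.NavierStokesRegularity.NavierStokesRegularity.Theorems.GaussianGap
open Summit.NavierStokesRegularity.NavierStokesRegularity.Theorems.SimilarityEnstrophy
open Summit.NavierStokesRegularity.NavierStokesRegularity.Theorems.SmallDissipationGap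
open Summit.NavierStokesRegularity.NavierStokesRegularity.Theorems.FiniteDissipationLiouville

variable {C : ℝ} {V : ℝ → (EuclideanSpace ℝ (Fin 3)) → (EuclideanSpace ℝ (Fin 3))}

/-! ### The budget with the dissipation kept -/

section Budget

/-- **The localised dissipation is monotone in the cutoff radius** (`φ_R² ≤ φ_{R'}²` for `R ≤ R'`,
non-negative integrand). [folklore] -/
theorem sqCutoffDissipation_mono (hV : IsTypeIAncientMild C V) {R R' : ℝ} (hR : 0 < R) (hRR' : R ≤ R')
    (s : ℝ) :
    ∫ y, smoothTransition (2 - ‖y‖ ^ 2 / R ^ 2) ^ 2 * frobeniusNormSq (fderiv ℝ (lerayVorticity V s) y) ≤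
      ∫ y, smoothTransition (2 - ‖y‖ ^ 2 / R' ^ 2) ^ 2 *
        frobeniusNormSq (fderiv ℝ (lerayVorticity V s) y) := by
  have hR' : 0 < R' := lt_of_lt_of_le hR hRR'
  have hcF : Continuous fun y => frobeniusNormSq (fderiv ℝ (lerayVorticity V s) y) :=
    continuous_frobeniusNormSq_fderiv_lerayVorticity hV s
  have hint : ∀ ρ : ℝ, 0 < ρ → Integrable fun y => smoothTransition (2 - ‖y‖ ^ 2 / ρ ^ 2) ^ 2 *
      frobeniusNormSq (fderiv ℝ (lerayVorticity V s) y) := fun ρ hρ =>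
    ((contDiff_sqCutoff (n := 1) ρ).continuous.mul hcF).integrable_of_hasCompactSupport
      (hasCompactSupport_sqCutoff hρ).mul_right
  refine integral_mono (hint R hR) (hint R' hR') fun y => ?_
  refine mul_le_mul_of_nonneg_right ?_ (frobeniusNormSq_nonneg _)
  have h1 : ‖y‖ ^ 2 / R' ^ 2 ≤ ‖y‖ ^ 2 / R ^ 2 :=
    div_le_div_of_nonneg_left (sq_nonneg _) (by positivity) (pow_le_pow_left₀ hR.le hRR' 2)
  exact pow_le_pow_left₀ (smoothTransition_cutoff_nonneg R y)
    (Real.smoothTransition.monotone (by linarith)) 2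

/-- **The budget with the dissipation kept.** Let `V ∈ 𝒟_{C,K}` satisfy a linear stretching bound
`2∫φ_R²⟪DU Ω, Ω⟫(σ) ≤ κ ∫‖Ω(σ)‖²` (all `σ`, all `R > 0`; `κ ≥ 0`). There is `L ≥ 0` such that: if
`∫‖Ω(σ)‖² ≤ m` for all `σ` and, for some `R ≥ 1`, `η ≤ D_R(σ) = ∫φ_R²|∇Ω(σ)|²_F` for all `σ`, then
`Z_R(σ) ≤ (κ m − 2η + LM/R)/(1/2)` for all `σ` (`M = ‖curlCLM‖² max K 0`): the squared-cutoff
identity, the signed drift flux, the collar fluxes `≤ LM/R`, and the backward ODE bound for the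
ANCIENT orbit. [folklore energy method] -/
theorem exists_budget_le (hV : IsTypeIAncientMild C V) {K : ℝ}
    (hK : ∀ t : ℝ, t < 0 → ∫⁻ x, ‖fderiv ℝ (V t) x‖ₑ ^ 2 ≤ ENNReal.ofReal (K / Real.sqrt (-t)))
    {κ : ℝ} (hκ : 0 ≤ κ)
    (hstr : ∀ σ : ℝ, ∀ R : ℝ, 0 < R →
      2 * (∫ y, smoothTransition (2 - ‖y‖ ^ 2 / R ^ 2) ^ 2 *
        ⟪fderiv ℝ (lerayOrbit V σ) y (lerayVorticity V σ y), lerayVorticity V σ y⟫) ≤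
        κ * ∫ y, ‖lerayVorticity V σ y‖ ^ 2) :
    ∃ L : ℝ, 0 ≤ L ∧ ∀ m : ℝ, (∀ s, ∫ y, ‖lerayVorticity V s y‖ ^ 2 ≤ m) →
      ∀ R : ℝ, 1 ≤ R → ∀ η : ℝ,
        (∀ σ, η ≤ ∫ y, smoothTransition (2 - ‖y‖ ^ 2 / R ^ 2) ^ 2 *
          frobeniusNormSq (fderiv ℝ (lerayVorticity V σ) y)) →
        ∀ σ, (∫ y, smoothTransition (2 - ‖y‖ ^ 2 / R ^ 2) ^ 2 * ‖lerayVorticity V σ y‖ ^ 2) ≤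
          (κ * m - 2 * η + L / R * (‖curlCLM‖ ^ 2 * max K 0)) / (1 / 2) := by
  obtain ⟨c₁, hc₁0, hc₁⟩ :=
    exists_norm_fderiv_smoothTransition_cutoff_le (E := (EuclideanSpace ℝ (Fin 3)))
  obtain ⟨c₂, hc₂0, hc₂⟩ :=
    exists_abs_laplacian_smoothTransition_cutoff_le (E := (EuclideanSpace ℝ (Fin 3)))
  have hC : 0 ≤ C := hV.nonneg
  have hΩi := fun σ => integrable_sq_norm_lerayVorticity hV hK σ
  set M : ℝ := ‖curlCLM‖ ^ 2 * max K 0 with hMdef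
  have hM0 : 0 ≤ M := by positivity
  set L : ℝ := 2 * C * c₁ + 2 * c₂ + 6 * c₁ ^ 2 with hLdef
  have hL0 : 0 ≤ L := by positivity
  refine ⟨L, hL0, fun m hm R hR1 η hη => ?_⟩
  have hR : 0 < R := lt_of_lt_of_le one_pos hR1
  have hd : Differentiable ℝ fun σ =>
      ∫ y, smoothTransition (2 - ‖y‖ ^ 2 / R ^ 2) ^ 2 * ‖lerayVorticity V σ y‖ ^ 2 :=
    fun σ => (hasDerivAt_sqCutoffEnstrophy hV hR σ).differentiableAt
  have hle : ∀ σ, (∫ y, smoothTransition (2 - ‖y‖ ^ 2 / R ^ 2) ^ 2 * ‖lerayVorticity V σ y‖ ^ 2) ≤ M := by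
    intro σ
    calc (∫ y, smoothTransition (2 - ‖y‖ ^ 2 / R ^ 2) ^ 2 * ‖lerayVorticity V σ y‖ ^ 2)
        ≤ ∫ y, ‖lerayVorticity V σ y‖ ^ 2 := by
          refine integral_mono_of_nonneg (Eventually.of_forall fun y =>
            mul_nonneg (sq_nonneg _) (sq_nonneg _)) (hΩi σ).1 (Eventually.of_forall fun y => ?_)
          have h1 := sqCutoff_le_one R y
          have h0 : 0 ≤ ‖lerayVorticity V σ y‖ ^ 2 := sq_nonneg _
          nlinarith
      _ ≤ M := (hΩi σ).2
  have hI : ∀ σ, (∫ y in closedBall (0 : EuclideanSpace ℝ (Fin 3)) (2 * R), ‖lerayVorticity V σ y‖ ^ 2) ≤ M :=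
    fun σ => (setIntegral_le_integral (hΩi σ).1 (Eventually.of_forall fun y => sq_nonneg _)).trans (hΩi σ).2
  have hZ' : ∀ σ, deriv (fun σ' =>
      ∫ y, smoothTransition (2 - ‖y‖ ^ 2 / R ^ 2) ^ 2 * ‖lerayVorticity V σ' y‖ ^ 2) σ ≤
      -(1 / 2) * (∫ y, smoothTransition (2 - ‖y‖ ^ 2 / R ^ 2) ^ 2 * ‖lerayVorticity V σ y‖ ^ 2) +
        (κ * m - 2 * η + L / R * M) := by
    intro σ
    rw [deriv_sqCutoffEnstrophy_eq hV hR σ]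
    set φ : (EuclideanSpace ℝ (Fin 3)) → ℝ := fun z => smoothTransition (2 - ‖z‖ ^ 2 / R ^ 2) with hφdef
    set Ω := lerayVorticity V σ with hΩdef
    set U := lerayOrbit V σ with hUdef
    set I : ℝ := ∫ y in closedBall (0 : (EuclideanSpace ℝ (Fin 3))) (2 * R), ‖Ω y‖ ^ 2 with hIdef
    have hI0 : 0 ≤ I := integral_nonneg fun y => sq_nonneg _
    have hIM : I ≤ M := hI σ
    have hDη : η ≤ ∫ y, φ y ^ 2 * frobeniusNormSq (fderiv ℝ Ω y) := hη σ
    have hΩ1 : ContDiff ℝ 1 Ω := signedBudget_contDiff_lerayVorticity_slice hV σ (n := 1)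
    have hcΩ : Continuous Ω := hΩ1.continuous
    have hUC : ∀ y, ‖U y‖ ≤ C := fun y => norm_lerayOrbit_le_of_typeI hV σ y
    have hw1 : ContDiff ℝ 1 fun z : (EuclideanSpace ℝ (Fin 3)) => φ z ^ 2 := contDiff_sqCutoff (n := 1) R
    have hw2 : ContDiff ℝ 2 fun z : (EuclideanSpace ℝ (Fin 3)) => φ z ^ 2 := contDiff_sqCutoff (n := 2) R
    have hcDw : Continuous (fderiv ℝ fun z : (EuclideanSpace ℝ (Fin 3)) => φ z ^ 2) :=
      hw1.continuous_fderiv one_ne_zero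
    -- (1) drift flux `≤ 0`
    have hDrift : (∫ y, fderiv ℝ (fun z : (EuclideanSpace ℝ (Fin 3)) => φ z ^ 2) y y * ‖Ω y‖ ^ 2) ≤ 0 :=
      integral_nonpos fun y => mul_nonpos_iff.2 (Or.inr ⟨fderiv_sqCutoff_self_nonpos R y, sq_nonneg _⟩)
    -- (2) transport flux
    have hT : |∫ y, fderiv ℝ (fun z : (EuclideanSpace ℝ (Fin 3)) => φ z ^ 2) y (U y) * ‖Ω y‖ ^ 2| ≤
        C * (2 * (c₁ / R)) * I := by
      refine abs_integral_le_of_weight_sq hcΩ (w := fun y => C * ‖fderiv ℝ (fun z : (EuclideanSpace ℝ (Fin 3)) => φ z ^ 2) y‖)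
        (continuous_const.mul hcDw.norm) (fun y hy => ?_) (fun y _ => ?_) (fun y => ?_)
      · show C * ‖fderiv ℝ (fun z : (EuclideanSpace ℝ (Fin 3)) => φ z ^ 2) y‖ = 0
        rw [hφdef, fderiv_sqCutoff_eq_zero hR hy, norm_zero, mul_zero]
      · exact mul_le_mul_of_nonneg_left (norm_fderiv_sqCutoff_le hc₁ hR y) hC
      · rw [abs_mul, abs_of_nonneg (sq_nonneg ‖Ω y‖)]
        have e1 : |fderiv ℝ (fun z : (EuclideanSpace ℝ (Fin 3)) => φ z ^ 2) y (U y)| ≤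
            ‖fderiv ℝ (fun z : (EuclideanSpace ℝ (Fin 3)) => φ z ^ 2) y‖ * C := by
          rw [← Real.norm_eq_abs]
          exact (ContinuousLinearMap.le_opNorm _ _).trans
            (mul_le_mul_of_nonneg_left (hUC y) (norm_nonneg _))
        calc |fderiv ℝ (fun z : (EuclideanSpace ℝ (Fin 3)) => φ z ^ 2) y (U y)| * ‖Ω y‖ ^ 2
            ≤ (‖fderiv ℝ (fun z : (EuclideanSpace ℝ (Fin 3)) => φ z ^ 2) y‖ * C) * ‖Ω y‖ ^ 2 :=
              mul_le_mul_of_nonneg_right e1 (sq_nonneg _)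
          _ = C * ‖fderiv ℝ (fun z : (EuclideanSpace ℝ (Fin 3)) => φ z ^ 2) y‖ * ‖Ω y‖ ^ 2 := by ring
    -- (3) viscous flux
    have hVisc : |∫ y, ‖Ω y‖ ^ 2 * (Δ (fun z : (EuclideanSpace ℝ (Fin 3)) => φ z ^ 2)) y| ≤
        (2 * (c₂ / R ^ 2) + 6 * (c₁ / R) ^ 2) * I := by
      refine abs_integral_le_of_weight_sq hcΩ (w := fun y => |(Δ (fun z : (EuclideanSpace ℝ (Fin 3)) => φ z ^ 2)) y|)
        (continuous_laplacian hw2).abs (fun y hy => ?_) (fun y _ => ?_) (fun y => ?_)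
      · show |(Δ (fun z : (EuclideanSpace ℝ (Fin 3)) => φ z ^ 2)) y| = 0
        rw [hφdef, laplacian_sqCutoff_eq_zero hR hy, abs_zero]
      · exact abs_laplacian_sqCutoff_le hc₁ hc₂ hR y
      · rw [abs_mul, abs_of_nonneg (sq_nonneg ‖Ω y‖), mul_comm]
    -- (4) stretching, linear in the global enstrophy by hypothesis
    have hS := hstr σ R hR
    have hSm : κ * ∫ y, ‖lerayVorticity V σ y‖ ^ 2 ≤ κ * m :=
      mul_le_mul_of_nonneg_left (hm σ) hκ
    -- absorption
    have hT' := (le_abs_self _).trans hT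
    have hVisc' := (le_abs_self _).trans hVisc
    have hR2 : 1 / R ^ 2 ≤ 1 / R := by
      rw [div_le_div_iff₀ (by positivity) hR]
      nlinarith
    have hc₂R : c₂ / R ^ 2 ≤ c₂ / R := by
      have := mul_le_mul_of_nonneg_left hR2 hc₂0
      simpa only [mul_one_div] using this
    have hc₁R : (c₁ / R) ^ 2 ≤ c₁ ^ 2 / R := by
      rw [div_pow]
      have := mul_le_mul_of_nonneg_left hR2 (sq_nonneg c₁)
      simpa only [mul_one_div] using this
    have a1 : C * (2 * (c₁ / R)) * I ≤ C * (2 * (c₁ / R)) * M :=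
      mul_le_mul_of_nonneg_left hIM (by positivity)
    have a2 : (2 * (c₂ / R ^ 2) + 6 * (c₁ / R) ^ 2) * I ≤ (2 * (c₂ / R) + 6 * (c₁ ^ 2 / R)) * M :=
      (mul_le_mul_of_nonneg_right (by linarith [hc₂R, hc₁R]) hI0).trans
        (mul_le_mul_of_nonneg_left hIM (by positivity))
    have e : L / R * M = C * (2 * (c₁ / R)) * M + (2 * (c₂ / R) + 6 * (c₁ ^ 2 / R)) * M := by
      rw [hLdef]; field_simp; ring
    rw [e]
    linarith [hDrift, hT', hVisc', hS, hSm, hDη, a1, a2]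
  exact le_div_of_deriv_le_neg_mul_add hd ⟨M, hle⟩ (by norm_num : (0:ℝ) < 1 / 2) hZ'

/-- **At or below the threshold the localised dissipation is somewhere small.** Let `V ∈ 𝒟_{C,K}`
have `‖Ω(s,y)‖ ≤ C_ω` with `0 ≤ C_ω ≤ √3/4`. Then for every `R ≥ 1` and `η > 0` some similarity time
`σ` has `D_R(σ) = ∫φ_R²|∇Ω(σ)|²_F < η`. Otherwise `D_{R'}(σ) ≥ η` for all `σ` and all `R' ≥ R`
(monotonicity), and with `m = sup_σ Z_∞(σ)` and `κ = (2/√3)C_ω` (`2κ ≤ 1`) the budget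
`exists_budget_le` and `R' → ∞` give `Z_∞(σ) ≤ 2κ m − 4η ≤ m − 4η` for every `σ` — against the
supremum. [folklore energy method] -/
theorem exists_sqCutoffDissipation_lt (hV : IsTypeIAncientMild C V) {K : ℝ}
    (hK : ∀ t : ℝ, t < 0 → ∫⁻ x, ‖fderiv ℝ (V t) x‖ₑ ^ 2 ≤ ENNReal.ofReal (K / Real.sqrt (-t)))
    {Cω : ℝ} (hCω0 : 0 ≤ Cω) (hCω : Cω ≤ Real.sqrt 3 / 4) (hΩ : ∀ s y, ‖lerayVorticity V s y‖ ≤ Cω)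
    {R : ℝ} (hR1 : 1 ≤ R) {η : ℝ} (hη : 0 < η) :
    ∃ σ : ℝ, ∫ y, smoothTransition (2 - ‖y‖ ^ 2 / R ^ 2) ^ 2 *
      frobeniusNormSq (fderiv ℝ (lerayVorticity V σ) y) < η := by
  by_contra hcon
  push Not at hcon
  have hR : 0 < R := lt_of_lt_of_le one_pos hR1
  have hΩi := fun σ => integrable_sq_norm_lerayVorticity hV hK σ
  set M : ℝ := ‖curlCLM‖ ^ 2 * max K 0 with hMdef
  -- the stretching bound with `κ = (2/√3) C_ω`, `2κ ≤ 1`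
  set κ : ℝ := 2 * Cω * Real.sqrt 3 / 3 with hκdef
  have hκ0 : 0 ≤ κ := by positivity
  have h3 : Real.sqrt 3 ^ 2 = 3 := Real.sq_sqrt (by norm_num)
  have hs0 : 0 < Real.sqrt 3 := Real.sqrt_pos.2 (by norm_num)
  have hκ1 : 2 * κ ≤ 1 := by
    rw [hκdef]
    have : Cω * Real.sqrt 3 ≤ Real.sqrt 3 / 4 * Real.sqrt 3 := mul_le_mul_of_nonneg_right hCω hs0.le
    nlinarith
  have hstr := fun σ (R : ℝ) (hR : 0 < R) =>
    two_mul_integral_sqCutoff_stretching_le_sharp hV hK hCω0 σ (hΩ σ) hR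
  obtain ⟨L, hL0, hbudget⟩ := exists_budget_le hV hK hκ0 hstr
  -- the supremum of the global enstrophy
  set Z : ℝ → ℝ := fun σ => ∫ y, ‖lerayVorticity V σ y‖ ^ 2 with hZdef
  have hZM : ∀ σ, Z σ ≤ M := fun σ => (hΩi σ).2
  have hZ0 : ∀ σ, 0 ≤ Z σ := fun σ => integral_nonneg fun y => sq_nonneg _
  have hbdd : BddAbove (range Z) := ⟨M, forall_mem_range.2 hZM⟩
  set m : ℝ := sSup (range Z) with hmdef
  have hZm : ∀ σ, Z σ ≤ m := fun σ => le_csSup hbdd ⟨σ, rfl⟩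
  have hm0 : 0 ≤ m := (hZ0 0).trans (hZm 0)
  -- the dissipation floor on every larger cutoff
  have hηR : ∀ R' : ℝ, R ≤ R' → ∀ σ, η ≤ ∫ y, smoothTransition (2 - ‖y‖ ^ 2 / R' ^ 2) ^ 2 *
      frobeniusNormSq (fderiv ℝ (lerayVorticity V σ) y) := fun R' hRR' σ =>
    (hcon σ).trans (sqCutoffDissipation_mono hV hR hRR' σ)
  -- `Z_∞(σ) ≤ 2κ m − 4η` for every `σ`
  have hZle : ∀ σ, Z σ ≤ (κ * m - 2 * η + 0 * M) / (1 / 2) := by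
    intro σ
    have hcΩ : Continuous (lerayVorticity V σ) :=
      (signedBudget_contDiff_lerayVorticity_slice hV σ (n := 1)).continuous
    have hball : ∀ᶠ n : ℕ in atTop,
        (∫ y in closedBall (0 : EuclideanSpace ℝ (Fin 3)) n, ‖lerayVorticity V σ y‖ ^ 2) ≤
          (κ * m - 2 * η + L / n * M) / (1 / 2) := by
      filter_upwards [eventually_ge_atTop ⌈R⌉₊] with n hn
      have hRn : R ≤ (n : ℝ) := (Nat.le_ceil R).trans (by exact_mod_cast hn)
      have hn1 : (1 : ℝ) ≤ n := hR1.trans hRn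
      have hn0 : (0 : ℝ) < n := lt_of_lt_of_le one_pos hn1
      refine le_trans ?_ (hbudget m hZm n hn1 η (hηR n hRn) σ)
      have hint : Integrable fun y => smoothTransition (2 - ‖y‖ ^ 2 / (n : ℝ) ^ 2) ^ 2 *
          ‖lerayVorticity V σ y‖ ^ 2 :=
        (((contDiff_sqCutoff (n := 1) (n : ℝ)).continuous).mul (hcΩ.norm.pow 2)).integrable_of_hasCompactSupport
          ((hasCompactSupport_sqCutoff hn0).mul_right)
      calc (∫ y in closedBall (0 : EuclideanSpace ℝ (Fin 3)) n, ‖lerayVorticity V σ y‖ ^ 2)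
          = ∫ y in closedBall (0 : EuclideanSpace ℝ (Fin 3)) n,
              smoothTransition (2 - ‖y‖ ^ 2 / (n : ℝ) ^ 2) ^ 2 * ‖lerayVorticity V σ y‖ ^ 2 := by
            refine setIntegral_congr_fun measurableSet_closedBall fun y hy => ?_
            rw [mem_closedBall, dist_zero_right] at hy
            rw [sqCutoff_eq_one hn0 hy, one_mul]
        _ ≤ ∫ y, smoothTransition (2 - ‖y‖ ^ 2 / (n : ℝ) ^ 2) ^ 2 * ‖lerayVorticity V σ y‖ ^ 2 :=
            setIntegral_le_integral hint (Eventually.of_forall fun y =>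
              mul_nonneg (sq_nonneg _) (sq_nonneg _))
    have hlim : Tendsto (fun n : ℕ =>
        ∫ y in closedBall (0 : EuclideanSpace ℝ (Fin 3)) n, ‖lerayVorticity V σ y‖ ^ 2) atTop
        (𝓝 (Z σ)) := by
      have h := tendsto_setIntegral_of_monotone (μ := (volume : Measure (EuclideanSpace ℝ (Fin 3))))
        (s := fun n : ℕ => closedBall (0 : EuclideanSpace ℝ (Fin 3)) n)
        (f := fun y => ‖lerayVorticity V σ y‖ ^ 2) (fun n => measurableSet_closedBall)
        (fun m n hmn => closedBall_subset_closedBall (by exact_mod_cast hmn))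
        (by rw [iUnion_closedBall_nat]; exact (hΩi σ).1.integrableOn)
      rwa [iUnion_closedBall_nat, Measure.restrict_univ] at h
    have hlim0 : Tendsto (fun n : ℕ => (κ * m - 2 * η + L / n * M) / (1 / 2)) atTop
        (𝓝 ((κ * m - 2 * η + 0 * M) / (1 / 2))) :=
      (((tendsto_const_div_atTop_nhds_zero_nat L).mul_const M).const_add _).div_const _
    exact le_of_tendsto_of_tendsto hlim hlim0 hball
  have hZle' : ∀ σ, Z σ ≤ m - 4 * η := by
    intro σ
    have h := hZle σ
    have e : (κ * m - 2 * η + 0 * M) / (1 / 2) = 2 * κ * m - 4 * η := by ring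
    rw [e] at h
    have : 2 * κ * m ≤ 1 * m := mul_le_mul_of_nonneg_right hκ1 hm0
    linarith
  have hsup : m ≤ m - 4 * η := csSup_le (range_nonempty Z) (forall_mem_range.2 hZle')
  linarith

end Budget

/-! ### Continuity of the localised dissipation along KNSS-convergent sequences -/

section Continuity

/-- The Frobenius norm is continuous on `E →L F`. [folklore] -/
theorem continuous_frobeniusNormSq_clm :
    Continuous fun L : (EuclideanSpace ℝ (Fin 3)) →L[ℝ] (EuclideanSpace ℝ (Fin 3)) => frobeniusNormSq L := by
  unfold frobeniusNormSq
  exact continuous_finsetSum _ fun i _ =>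
    ((ContinuousLinearMap.apply ℝ (EuclideanSpace ℝ (Fin 3))
      (stdOrthonormalBasis ℝ (EuclideanSpace ℝ (Fin 3)) i)).continuous.norm.pow 2)

/-- **The localised dissipation at similarity time `0` is continuous along KNSS-convergent
sequences of the class.** For Type-I ancient mild `v j`, `W` with a common constant `C` converging
uniformly on the slab pieces: for every `R > 0`,
`∫φ_R²|D(curl v_j(−1))|²_F → ∫φ_R²|D(curl W(−1))|²_F` (dominated convergence; class-uniform bound
`‖D(curl f(−1))‖ ≤ ‖curlCLM‖K₂`; pointwise convergence by `ThresholdOne.tendsto_fderiv_curl_slice`). [cite: KochNadirashviliSereginSverak2009, Prop. 4.1 (arXiv:0709.3599 p. 8)] -/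
theorem tendsto_sqCutoffDissipation_zero {v : ℕ → ℝ → EuclideanSpace ℝ (Fin 3) → EuclideanSpace ℝ (Fin 3)}
    {W : ℝ → EuclideanSpace ℝ (Fin 3) → EuclideanSpace ℝ (Fin 3)}
    (hv : ∀ j, IsTypeIAncientMild C (v j)) (hW : IsTypeIAncientMild C W)
    (hunif : ∀ n : ℕ, TendstoUniformlyOn (fun j z => v j z.1 z.2) (fun z => W z.1 z.2) atTop
      (Icc (-((n : ℝ) + 2)) (-(1 / ((n : ℝ) + 2))) ×ˢ
        closedBall (0 : EuclideanSpace ℝ (Fin 3)) ((n : ℝ) + 2)))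
    {R : ℝ} (hR : 0 < R) :
    Tendsto (fun j => ∫ y, smoothTransition (2 - ‖y‖ ^ 2 / R ^ 2) ^ 2 *
        frobeniusNormSq (fderiv ℝ (curl (v j (-1))) y)) atTop
      (𝓝 (∫ y, smoothTransition (2 - ‖y‖ ^ 2 / R ^ 2) ^ 2 *
        frobeniusNormSq (fderiv ℝ (curl (W (-1))) y))) := by
  obtain ⟨K₂, hK₂0, hK₂⟩ := ThresholdOne.exists_norm_iteratedFDeriv_slice_le C 2
  set κc : ℝ := ‖curlCLM‖ with hκc
  have hκc0 : 0 ≤ κc := by rw [hκc]; exact norm_nonneg curlCLM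
  have hsm : ∀ (f : ℝ → EuclideanSpace ℝ (Fin 3) → EuclideanSpace ℝ (Fin 3)), IsTypeIAncientMild C f →
      ContDiff ℝ (⊤ : ℕ∞) (f (-1)) := fun f hf => hf.contDiff_slice (by norm_num)
  have hbd : ∀ (f : ℝ → EuclideanSpace ℝ (Fin 3) → EuclideanSpace ℝ (Fin 3)), IsTypeIAncientMild C f →
      ∀ z, frobeniusNormSq (fderiv ℝ (curl (f (-1))) z) ≤ 3 * (κc * K₂) ^ 2 := by
    intro f hf z
    have h1 : ‖fderiv ℝ (curl (f (-1))) z‖ ≤ κc * K₂ := by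
      rw [← norm_iteratedFDeriv_one]
      exact (norm_iteratedFDeriv_curl_le_opNorm_mul (hsm f hf) 1 le_top z).trans
        (mul_le_mul_of_nonneg_left (hK₂ hf z) hκc0)
    exact (ChaeLocalLeray.frobeniusNormSq_le_three _).trans
      (mul_le_mul_of_nonneg_left (pow_le_pow_left₀ (norm_nonneg _) h1 2) (by norm_num))
  have hcont : ∀ (f : ℝ → EuclideanSpace ℝ (Fin 3) → EuclideanSpace ℝ (Fin 3)), IsTypeIAncientMild C f →
      Continuous fun z => frobeniusNormSq (fderiv ℝ (curl (f (-1))) z) := fun f hf =>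
    continuous_frobeniusNormSq_fderiv (contDiff_curl ((hsm f hf).of_le (by norm_cast)) (n := 1))
      (by simp)
  set φ : (EuclideanSpace ℝ (Fin 3)) → ℝ := fun z => smoothTransition (2 - ‖z‖ ^ 2 / R ^ 2) with hφdef
  have hcφ : Continuous fun z => φ z ^ 2 := (contDiff_sqCutoff (n := 1) R).continuous
  have hφc : HasCompactSupport fun z => φ z ^ 2 := hasCompactSupport_sqCutoff hR
  refine tendsto_integral_of_dominated_convergence (fun z => φ z ^ 2 * (3 * (κc * K₂) ^ 2))
    (fun j => (hcφ.mul (hcont _ (hv j))).aestronglyMeasurable)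
    ((hcφ.mul continuous_const).integrable_of_hasCompactSupport hφc.mul_right)
    (fun j => Eventually.of_forall fun z => ?_) (Eventually.of_forall fun z => ?_)
  · rw [Real.norm_of_nonneg (mul_nonneg (sq_nonneg _) (frobeniusNormSq_nonneg _))]
    exact mul_le_mul_of_nonneg_left (hbd _ (hv j) z) (sq_nonneg _)
  · exact tendsto_const_nhds.mul ((continuous_frobeniusNormSq_clm.tendsto _).comp
      (ThresholdOne.tendsto_fderiv_curl_slice hv hW hunif z))

end Continuity

end Summit.NavierStokesRegularity.NavierStokesRegularity.Theorems.FiniteDissipationLiouville.VorticityAmplitude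

end
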